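import Mathlib
import HarnessLib
import Summits.ValiantsHypothesis.ValiantsHypothesis.Theorems.MonotoneRestorationOrbitRestorationQPSmlPowerSums
import Summits.ValiantsHypothesis.ValiantsHypothesis.Theorems.MonotoneRestorationOrbitRestorationQPSmlDeltaCalculus

/-!
# Peeling tools for the narrowness lemma
(crux `OrbitRestorationQP`, stmt-ValiantsHypothesis-18293 — lane SML: the column-set-multilinear `ΣΠΣ` stratum of A_∞)

Tools for the peeling induction behind (N2) / the narrowness theorem (file `…SmlDeltaNarrow`; blueprint
`SML-STRATUM-BLUEPRINT.md` on the crux item):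

* `exists_perm_conj` — any two systems of `j` disjoint ordered pairs of distinct variables are conjugate under a
  permutation; `sum_deltaFold_psumProd_rename` — transport of a combination of `Δ_{a,b} p_μ` (the `p_μ` are symmetric);
* the PEELING FUNCTIONAL `q ↦ coeff_e (q | y₀ := t, y₁ := 0)`, written with two `finSuccEquiv`s as
  `((finSuccEquiv ℂ N) (((finSuccEquiv ℂ (N+1)) q).coeff e)).coeff 0`: coefficient formula, linearity, commutation
  with the partial derivatives / difference-derivative folds in the unpeeled (twice shifted) variables;
* `peel_delta_psumProd` — its value on `(∂_0 - ∂_1) Π_{k∈μ} p_k` at the least exponent `m₀` in play: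
  `count (m₀+1) μ · (m₀+1) · p_{μ ∖ (m₀+1)}`.
[folklore]
-/

set_option linter.dupNamespace false

namespace Summit.ValiantsHypothesis.ValiantsHypothesis.Theorems.SmlPeeling

open MvPolynomial SmlPowerSums SmlDeltaCalculus

/-! ### Transport: any two disjoint pair systems are conjugate -/

/-- Two systems of `j` disjoint ordered pairs of distinct elements of `Fin M` are conjugate under a permutation.
[folklore] -/
theorem exists_perm_conj {M j : ℕ} (a b a₁ b₁ : Fin j → Fin M)
    (ha : Function.Injective a) (hb : Function.Injective b) (hab : ∀ i i', a i ≠ b i')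
    (ha₁ : Function.Injective a₁) (hb₁ : Function.Injective b₁) (hab₁ : ∀ i i', a₁ i ≠ b₁ i') :
    ∃ g : Equiv.Perm (Fin M), (∀ i, g (a i) = a₁ i) ∧ ∀ i, g (b i) = b₁ i := by
  classical
  have hu : Function.Injective (Sum.elim a b) := Sum.elim_injective.2 ⟨ha, hb, hab⟩
  have hu₁ : Function.Injective (Sum.elim a₁ b₁) := Sum.elim_injective.2 ⟨ha₁, hb₁, hab₁⟩
  let e : {x // x ∈ Set.range (Sum.elim a b)} ≃ {x // x ∈ Set.range (Sum.elim a₁ b₁)} :=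
    (Equiv.ofInjective _ hu).symm.trans (Equiv.ofInjective _ hu₁)
  refine ⟨e.extendSubtype, fun i => ?_, fun i => ?_⟩
  · rw [Equiv.extendSubtype_apply_of_mem e (a i) ⟨Sum.inl i, rfl⟩]
    have : (⟨a i, ⟨Sum.inl i, rfl⟩⟩ : {x // x ∈ Set.range (Sum.elim a b)}) =
        ⟨Sum.elim a b (Sum.inl i), ⟨Sum.inl i, rfl⟩⟩ := rfl
    simp only [e, Equiv.trans_apply, this, Equiv.ofInjective_symm_apply]
    rfl
  · rw [Equiv.extendSubtype_apply_of_mem e (b i) ⟨Sum.inr i, rfl⟩]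
    have : (⟨b i, ⟨Sum.inr i, rfl⟩⟩ : {x // x ∈ Set.range (Sum.elim a b)}) =
        ⟨Sum.elim a b (Sum.inr i), ⟨Sum.inr i, rfl⟩⟩ := rfl
    simp only [e, Equiv.trans_apply, this, Equiv.ofInjective_symm_apply]
    rfl

/-- Transport of a vanishing combination of `Δ_{a,b} p_μ` along a permutation of the variables (the power-sum
products are symmetric). [folklore] -/
theorem sum_deltaFold_psumProd_rename {N j : ℕ} (a b : Fin j → Fin N) (g : Equiv.Perm (Fin N))
    (S : Finset (Multiset ℕ)) (c : Multiset ℕ → ℂ) :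
    rename g (∑ μ ∈ S, c μ • List.foldl (fun (q : MvPolynomial (Fin N) ℂ) i => pderiv (a i) q - pderiv (b i) q)
        ((μ.map (psum (Fin N) ℂ)).prod) (List.finRange j)) =
      ∑ μ ∈ S, c μ • List.foldl (fun (q : MvPolynomial (Fin N) ℂ) i => pderiv (g (a i)) q - pderiv (g (b i)) q)
        ((μ.map (psum (Fin N) ℂ)).prod) (List.finRange j) := by
  rw [map_sum]
  refine Finset.sum_congr rfl fun μ _ => ?_
  rw [map_smul, rename_deltaFoldList g g.injective]
  congr 1
  rw [map_multiset_prod, Multiset.map_map]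
  congr 2
  exact Multiset.map_congr rfl fun k _ => rename_psum (Fin N) ℂ k g

/-! ### The peeling functional `q ↦ coeff_e (q | y₀ := t, y₁ := 0)` -/

/-- Coefficient formula for the peeling functional. [folklore] -/
theorem coeff_peel {N : ℕ} (q : MvPolynomial (Fin (N + 2)) ℂ) (e : ℕ) (n' : Fin N →₀ ℕ) :
    coeff n' (((finSuccEquiv ℂ N) (((finSuccEquiv ℂ (N + 1)) q).coeff e)).coeff 0) =
      coeff ((n'.cons 0).cons e) q := by
  rw [finSuccEquiv_coeff_coeff, finSuccEquiv_coeff_coeff]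

/-- The peeling functional is additive. [folklore] -/
theorem peel_sub {N : ℕ} (q r : MvPolynomial (Fin (N + 2)) ℂ) (e : ℕ) :
    ((finSuccEquiv ℂ N) (((finSuccEquiv ℂ (N + 1)) (q - r)).coeff e)).coeff 0 =
      ((finSuccEquiv ℂ N) (((finSuccEquiv ℂ (N + 1)) q).coeff e)).coeff 0 -
        ((finSuccEquiv ℂ N) (((finSuccEquiv ℂ (N + 1)) r).coeff e)).coeff 0 := by
  simp only [map_sub, Polynomial.coeff_sub]

/-- The peeling functional is `ℂ`-homogeneous. [folklore] -/
theorem peel_smul {N : ℕ} (c : ℂ) (q : MvPolynomial (Fin (N + 2)) ℂ) (e : ℕ) :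
    ((finSuccEquiv ℂ N) (((finSuccEquiv ℂ (N + 1)) (c • q)).coeff e)).coeff 0 =
      c • ((finSuccEquiv ℂ N) (((finSuccEquiv ℂ (N + 1)) q).coeff e)).coeff 0 := by
  simp only [map_smul, Polynomial.coeff_smul]

/-- The peeling functional commutes with finite sums. [folklore] -/
theorem peel_sum {N : ℕ} {κ : Type*} (s : Finset κ) (q : κ → MvPolynomial (Fin (N + 2)) ℂ) (e : ℕ) :
    ((finSuccEquiv ℂ N) (((finSuccEquiv ℂ (N + 1)) (∑ x ∈ s, q x)).coeff e)).coeff 0 =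
      ∑ x ∈ s, ((finSuccEquiv ℂ N) (((finSuccEquiv ℂ (N + 1)) (q x)).coeff e)).coeff 0 := by
  simp only [map_sum, Polynomial.finsetSum_coeff]

/-- The peeling functional commutes with the partial derivatives in the unpeeled variables (shift by two).
[folklore] -/
theorem peel_pderiv {N : ℕ} (q : MvPolynomial (Fin (N + 2)) ℂ) (e : ℕ) (i : Fin N) :
    ((finSuccEquiv ℂ N) (((finSuccEquiv ℂ (N + 1)) (pderiv i.succ.succ q)).coeff e)).coeff 0 =
      pderiv i (((finSuccEquiv ℂ N) (((finSuccEquiv ℂ (N + 1)) q).coeff e)).coeff 0) := by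
  ext n'
  rw [coeff_peel, coeff_pderiv, coeff_pderiv, coeff_peel]
  have h1 : ((n'.cons 0).cons e : Fin (N + 2) →₀ ℕ) i.succ.succ = n' i := by
    rw [Finsupp.cons_succ, Finsupp.cons_succ]
  have h2 : ((n'.cons 0).cons e : Fin (N + 2) →₀ ℕ) + Finsupp.single i.succ.succ 1 =
      ((n' + Finsupp.single i 1).cons 0).cons e := by
    ext v
    refine Fin.cases ?_ (fun w => ?_) v
    · simp only [Finsupp.add_apply, Finsupp.cons_zero, Finsupp.single_apply]
      rw [if_neg (Fin.succ_ne_zero _), add_zero]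
    · refine Fin.cases ?_ (fun u => ?_) w
      · simp only [Finsupp.add_apply, Finsupp.cons_zero, Finsupp.cons_succ, Finsupp.single_apply, Fin.succ_inj]
        rw [if_neg (Fin.succ_ne_zero _), add_zero]
      · simp only [Finsupp.add_apply, Finsupp.cons_succ, Finsupp.single_apply, Fin.succ_inj]
  rw [h1, h2]

/-- The peeling functional commutes with the difference-derivative fold of a shifted pair system. [folklore] -/
theorem peel_deltaFoldList {N : ℕ} {ι : Type*} (a' b' : ι → Fin N) (e : ℕ) :
    ∀ (l : List ι) (q : MvPolynomial (Fin (N + 2)) ℂ),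
      ((finSuccEquiv ℂ N) (((finSuccEquiv ℂ (N + 1))
        (List.foldl (fun (q : MvPolynomial (Fin (N + 2)) ℂ) i =>
          pderiv (a' i).succ.succ q - pderiv (b' i).succ.succ q) q l)).coeff e)).coeff 0 =
      List.foldl (fun (q : MvPolynomial (Fin N) ℂ) i => pderiv (a' i) q - pderiv (b' i) q)
        (((finSuccEquiv ℂ N) (((finSuccEquiv ℂ (N + 1)) q).coeff e)).coeff 0) l := by
  intro l
  induction l with
  | nil => intro q; rfl
  | cons i l ih =>
    intro q
    simp only [List.foldl_cons]
    rw [ih, peel_sub, peel_pderiv, peel_pderiv]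

/-- `Σ_{k ∈ μ} [k = k₀] · T = count k₀ μ • T`. [folklore] -/
theorem sum_map_ite_eq_count_nsmul {A : Type*} [AddCommMonoid A] (k₀ : ℕ) (T : A) :
    ∀ μ : Multiset ℕ, (μ.map fun k => if k = k₀ then T else 0).sum = μ.count k₀ • T := by
  intro μ
  induction μ using Multiset.induction_on with
  | empty => simp
  | cons k μ ih =>
    rw [Multiset.map_cons, Multiset.sum_cons, ih]
    by_cases hk : k = k₀
    · subst hk
      rw [if_pos rfl, Multiset.count_cons_self, succ_nsmul', ]
    · rw [if_neg hk, Multiset.count_cons_of_ne (Ne.symm hk), zero_add]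

/-- The peeling functional on one difference-derivative step `(∂_0 - ∂_1) Π_{k∈μ} p_k` at the LEAST exponent in
play: if every part `k ≥ 2` of `μ` satisfies `m₀ + 1 ≤ k` (`m₀ ≥ 1`), the coefficient of `t^{m₀}` of
`Σ_{k∈μ} k (t^{k-1} - 0^{k-1}) Π_{l∈μ∖k} (t^l + p_l)` is `count (m₀+1) μ · (m₀+1) · p_{μ ∖ (m₀+1)}`. [folklore] -/
theorem peel_delta_psumProd {N : ℕ} (μ : Multiset ℕ) (hμ : ∀ k ∈ μ, 0 < k) (m₀ : ℕ) (hm₀ : 0 < m₀)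
    (hbig : ∀ k ∈ μ, 2 ≤ k → m₀ + 1 ≤ k) :
    ((finSuccEquiv ℂ N) (((finSuccEquiv ℂ (N + 1))
      (pderiv 0 ((μ.map (psum (Fin (N + 2)) ℂ)).prod) -
        pderiv 1 ((μ.map (psum (Fin (N + 2)) ℂ)).prod))).coeff m₀)).coeff 0 =
      ((μ.count (m₀ + 1) : ℂ) * (m₀ + 1 : ℂ)) • ((μ.erase (m₀ + 1)).map (psum (Fin N) ℂ)).prod := by
  classical
  -- the ring homomorphism `φ : q ↦ (finSuccEquiv q).map ψ`, `ψ r = (finSuccEquiv r).coeff 0`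
  set ψ : MvPolynomial (Fin (N + 1)) ℂ →+* MvPolynomial (Fin N) ℂ :=
    Polynomial.constantCoeff.comp
      (finSuccEquiv ℂ N : MvPolynomial (Fin (N + 1)) ℂ →+* Polynomial (MvPolynomial (Fin N) ℂ)) with hψ
  set φ : MvPolynomial (Fin (N + 2)) ℂ →+* Polynomial (MvPolynomial (Fin N) ℂ) :=
    (Polynomial.mapRingHom ψ).comp
      (finSuccEquiv ℂ (N + 1) : MvPolynomial (Fin (N + 2)) ℂ →+* Polynomial (MvPolynomial (Fin (N + 1)) ℂ))
    with hφ
  have hφapp : ∀ q : MvPolynomial (Fin (N + 2)) ℂ, φ q = ((finSuccEquiv ℂ (N + 1)) q).map ψ := by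
    intro q
    simp only [hφ, RingHom.coe_comp, Function.comp_apply, RingHom.coe_coe, Polynomial.coe_mapRingHom]
  have hψapp : ∀ r : MvPolynomial (Fin (N + 1)) ℂ, ψ r = ((finSuccEquiv ℂ N) r).coeff 0 := by
    intro r
    simp only [hψ, RingHom.coe_comp, Function.comp_apply, RingHom.coe_coe, Polynomial.constantCoeff_apply]
  have hpeel : ∀ (q : MvPolynomial (Fin (N + 2)) ℂ) (e : ℕ),
      ((finSuccEquiv ℂ N) (((finSuccEquiv ℂ (N + 1)) q).coeff e)).coeff 0 = (φ q).coeff e := by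
    intro q e
    rw [hφapp, Polynomial.coeff_map, hψapp]
  have hφX0 : φ (X 0) = Polynomial.X := by
    rw [hφapp, finSuccEquiv_X_zero, Polynomial.map_X]
  have hφX1 : φ (X 1) = 0 := by
    have h1 : (1 : Fin (N + 2)) = (0 : Fin (N + 1)).succ := rfl
    rw [hφapp, h1, finSuccEquiv_X_succ, Polynomial.map_C, hψapp, finSuccEquiv_X_zero, Polynomial.coeff_X_zero,
      map_zero]
  have hφpsum : ∀ k : ℕ, 0 < k → φ (psum (Fin (N + 2)) ℂ k) =
      Polynomial.X ^ k + Polynomial.C (psum (Fin N) ℂ k) := by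
    intro k hk
    rw [hφapp, finSuccEquiv_psum, Polynomial.map_add, Polynomial.map_pow, Polynomial.map_X, Polynomial.map_C,
      hψapp, finSuccEquiv_psum, Polynomial.coeff_add, Polynomial.coeff_C_zero, Polynomial.coeff_X_pow,
      if_neg hk.ne, zero_add]
  -- push `φ` through the one-step formula, coefficientwise
  rw [hpeel, delta_psumProd, map_multiset_sum, Multiset.map_map, ← Polynomial.lcoeff_apply, map_multiset_sum,
    Multiset.map_map]
  -- compute each summand's coefficient of `t^{m₀}`
  have hterm : ∀ k ∈ μ, ((Polynomial.lcoeff (MvPolynomial (Fin N) ℂ) m₀) ∘ (φ ∘ fun k : ℕ =>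
      ((k : ℕ) : MvPolynomial (Fin (N + 2)) ℂ) * (X 0 ^ (k - 1) - X 1 ^ (k - 1)) *
        ((μ.erase k).map (psum (Fin (N + 2)) ℂ)).prod)) k =
      if k = m₀ + 1 then ((m₀ + 1 : ℕ) : MvPolynomial (Fin N) ℂ) *
        ((μ.erase (m₀ + 1)).map (psum (Fin N) ℂ)).prod else 0 := by
    intro k hk
    have hpos' : ∀ l ∈ μ.erase k, 0 < l := fun l hl => hμ l (Multiset.mem_of_mem_erase hl)
    simp only [Function.comp_apply, Polynomial.lcoeff_apply, map_mul, map_sub, map_pow, map_natCast, hφX0, hφX1,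
      map_multiset_prod, Multiset.map_map]
    have hprod : ((μ.erase k).map fun x => φ (psum (Fin (N + 2)) ℂ x)) =
        (μ.erase k).map fun l => Polynomial.X ^ l + Polynomial.C (psum (Fin N) ℂ l) :=
      Multiset.map_congr rfl fun l hl => by rw [hφpsum l (hpos' l hl)]
    rw [hprod]
    rcases Nat.lt_or_ge k 2 with hk2 | hk2
    · -- unit part: the prefactor `t^0 - 0^0` vanishes
      have hk1 : k = 1 := by have := hμ k hk; omega
      subst hk1
      simp [hm₀.ne']
    · have hk1 : k - 1 ≠ 0 := by omega
      rw [zero_pow hk1, sub_zero, ← map_natCast Polynomial.C k, mul_assoc, Polynomial.coeff_C_mul,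
        Polynomial.coeff_X_pow_mul']
      have hmk : m₀ + 1 ≤ k := hbig k hk hk2
      by_cases hkeq : k = m₀ + 1
      · subst hkeq
        rw [if_pos (by omega), if_pos rfl, show m₀ - (m₀ + 1 - 1) = 0 by omega,
          coeff_zero_prod_X_pow_add_C _ _ hpos']
      · have hlt : ¬ k - 1 ≤ m₀ := by omega
        rw [if_neg hlt, if_neg hkeq, mul_zero]
  rw [Multiset.map_congr rfl hterm, sum_map_ite_eq_count_nsmul, nsmul_eq_mul, smul_eq_C_mul, map_mul,
    map_natCast, map_add, map_natCast, map_one]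
  push_cast
  ring

end Summit.ValiantsHypothesis.ValiantsHypothesis.Theorems.SmlPeeling
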